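import Summits.Langlands.Langlands.Theorems.SqrtFiveQuarticCoversCertS3H8
import HarnessLib

/-!
# Route `Langlands/SqrtFiveQuarticCovers`, certificate `CertS3H8` (sheets 4.4 `X(s3,H8,b7)`, 4.8
# `X(s3,H8,e7)`; stmt-Langlands-23415) — the COORDINATE form of the certified datum, and kernel
# anchors for the two exceptional families of the printed affine model

Companion of `Theorems/SqrtFiveQuarticCoversCertS3H8.lean` (p669895; typ-1, audited ref-2
f0c4090a34bbca7d).  There the certified computation CERT-E9′ is the hypothesis `hE9`: «at every
point of FLS's printed canonical model of `X(s3,s5)` over a totally real quartic `K ∋ r`, `r² = 5`,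
the printed `j`-denominator vanishes or `JNum = (a + b r)·JDen`».  The two lineages of the datum
(eng-9 E9-COARSE `HOME/lg-quartmod-eng-9/evidence/e9-coarse/E9-COARSE.md` 75c718e0b5108ddd §1–3;
eng-3 `E9-RESULT.md` 00025806a59bf964 §3; certnum RELEASES l.131–l.134) actually OUTPUT a statement
about COORDINATES, not about `j` (ref-2 ADVISORY 20:43:54Z (A2), AUDIT §hE9): «`K` totally real,
`[K : k] = 2` ⇒ every affine `K`-point `(w, u, v)` of FLS's model (s3s5) has `w ∈ k` AND `v ∈ k`»,
and the passage to `j ∈ k` is the sentence "(js3s5) involves only `w` and `v`" of the source plus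
closure of `k = ℚ(√5)` under field operations.  This file TYPES THAT WEAKER, LITERAL FORM
(`hE9c` below: in the chart `x₄ ≠ 0`, off `x₃² − x₃x₄ − x₄² = 0`, `w = x₃/x₄` and `v = x₂x₃/x₄²`
lie in `ℚ + ℚ·r`, division-free) and moves the passage to `j` INTO THE KERNEL:

* `s3s5R₁_smul`, `s3s5R₂_smul`, `s3s5JNum_chart`, `s3s5JDen_chart` — homogeneity of the printed
  (js3s5) pieces: `JNum(x₂, w·x₄, x₄) = x₄⁴⁵·(R₁(w) + R₂(w)·v)³` when `x₂·w = v·x₄`, and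
  `JDen(w·x₄, x₄) = x₄⁴⁵·8(w² − w − 1)¹⁵` (pure ring identities);
* `mem_adjoin_sqrt_five_iff` — `ℚ⟮r⟯ = {a + b·r}` for `r² = 5` (power basis; the tree's
  `minpoly_eq_X_sq_sub_five`), and `s3s5_jValue_mem_adjoin` — `w, v ∈ ℚ⟮r⟯ ⇒
  (R₁(w) + R₂(w)v)³ / (8(w² − w − 1)¹⁵) ∈ ℚ⟮r⟯`;
* **`certS3H8_of_facts_coords (hM) (hE9c) : …Theses…CertS3H8`** — the route child BY NAME from the
  printed fact `FLS2015.s3s5_jRelation_of_isTorsionGaloisRep` and the COORDINATE datum, through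
  `certS3H8_of_facts` (its `hE9` is DERIVED here from `hE9c`).

KERNEL ANCHORS of the E9′ statement's two exceptional families (the only non-`k`-rational
behaviour over quadratic `K/k`, both over NON-totally-real fields — which is exactly why `hE9c`
carries `IsTotallyReal K`): on FLS's printed affine model (s3s5) `u² = w(w−1)(w²−w+4)`,
`v² = w(w³−4w²+12w−12)` with the printed `j = (R₁(w) + R₂(w)v)³/(8(w²−w−1)¹⁵)`,
* `s3s5_exceptional_w_one` — `w = 1` ⇒ `u = 0`, `v² = −3` and `j = 1728` (`R₁(1) = R₂(1) = 12`,
  `(12 + 12v)³ = −13824 = 1728·8·(−1)¹⁵`): the pair over `k(√−3)`;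
* `s3s5_exceptional_w_sq` — `w² − w + 4 = 0` ⇒ `u = 0`, `v² = 5(w − 4)` (`= 5·((1 ± √−15)/2)²`),
  `R₁(w) = 37500`, `R₂(w) = −1875w − 13125`, `w² − w − 1 = −5` and `j = 1728`
  (`(R₁ + R₂v)³ = 1728·8·(−5)¹⁵`, explicit cofactors): the points over `k(√−15)`;
* `sq_ne_neg_nat_of_isTotallyReal` — a totally real number field has no element with `x² = −n`,
  `n ≥ 1` (one real embedding suffices): so neither family has a point over the `K` of `hE9c`
  (`v² = −3`, resp. `(2w − 1)² = −15`).

HONEST STATUS: CONDITIONAL bookkeeping + kernel algebra; `certS3H8_of_facts_coords` holds modulo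
{the printed fact `hM`, the certified coordinate datum `hE9c` (two lineages + certnum l.131–l.134,
resting on the named rank-`0`/torsion inputs listed in the CertS3H8 module docstring)}; nothing here
proves modularity of any curve; «a certified finite datum is not a modularity statement».
References: [FreitasLeHungSiksek2015] §5.3, model (s3s5) and eqn (js3s5) (arXiv:1310.7088 pp. 26–27);
cell records CENSUS.md §15 row 4.4/4.8; ref-2 AUDIT-typ1-CertS3H8-CertB3H8.md f0c4090a34bbca7d.
-/

noncomputable section

set_option linter.dupNamespace false -- project-wide option; `Summit.Langlands.Langlands` is the mandated namespace

open scoped MatrixGroups NumberField Matrix Polynomial IntermediateField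
open NumberField Field Polynomial
open Literature.NumberTheory.Automorphic Literature.NumberTheory.GaloisRepresentations
open Literature.NumberTheory.Automorphic.FLS2015
open Summit.Langlands.Langlands.Theses.SqrtFiveQuarticCovers

namespace Summit.Langlands.Langlands.Theorems.SqrtFiveQuarticCovers

/-! ### §1 The real quadratic subfield `ℚ⟮r⟯ = {a + b·r}`, `r² = 5` -/

/-- For `r² = 5` in a field of characteristic `0`, the elements of `ℚ⟮r⟯` are exactly the
`a + b·r`, `a b : ℚ` (`minpoly_ℚ r = X² − 5`, power basis `1, r`). [folklore] -/
theorem mem_adjoin_sqrt_five_iff {K : Type} [Field K] [CharZero K] {r : K} (hr : r ^ 2 = 5)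
    (x : K) : x ∈ ℚ⟮r⟯ ↔ ∃ a b : ℚ, x = (a : K) + (b : K) * r := by
  constructor
  · intro hx
    have hr_int : IsIntegral ℚ r :=
      ⟨X ^ 2 - C 5, monic_X_pow_sub_C (5 : ℚ) two_ne_zero, by simp [hr]⟩
    obtain ⟨f, hf, hxf⟩ := (IntermediateField.adjoin.powerBasis hr_int).exists_eq_aeval ⟨x, hx⟩
    rw [IntermediateField.adjoin.powerBasis_dim, minpoly_eq_X_sq_sub_five hr,
      natDegree_X_pow_sub_C] at hf
    obtain ⟨a, b, hfab⟩ := exists_eq_X_add_C_of_natDegree_le_one (Nat.lt_succ_iff.mp hf)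
    refine ⟨b, a, ?_⟩
    have h : x = aeval r f := by
      have h' := congrArg Subtype.val hxf
      rw [IntermediateField.adjoin.powerBasis_gen,
        IntermediateField.AdjoinSimple.coe_aeval_gen_apply] at h'
      exact h'
    rw [h, hfab]
    simp only [map_add, map_mul, aeval_C, aeval_X, eq_ratCast]
    ring
  · rintro ⟨a, b, rfl⟩
    refine add_mem ?_ (mul_mem ?_ (IntermediateField.mem_adjoin_simple_self ℚ r))
    · rw [← eq_ratCast (algebraMap ℚ K) a]; exact ℚ⟮r⟯.algebraMap_mem a
    · rw [← eq_ratCast (algebraMap ℚ K) b]; exact ℚ⟮r⟯.algebraMap_mem b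

/-! ### §2 The printed `j`-map (js3s5) in the chart `x₄ ≠ 0`: homogeneity and `ℚ⟮r⟯`-membership -/

section Homogeneity

variable {R : Type*} [CommRing R]

/-- `R₁ʰ` is homogeneous of degree `15`: `R₁ʰ(w·t, t) = t¹⁵·R₁(w)`. [folklore] -/
theorem s3s5R₁_smul (w t : R) : s3s5R₁ (w * t) t = t ^ 15 * s3s5R₁ w 1 := by
  simp only [s3s5R₁]; ring

/-- `R₂ʰ` is homogeneous of degree `13`: `R₂ʰ(w·t, t) = t¹³·R₂(w)`. [folklore] -/
theorem s3s5R₂_smul (w t : R) : s3s5R₂ (w * t) t = t ^ 13 * s3s5R₂ w 1 := by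
  simp only [s3s5R₂]; ring

/-- The printed denominator in the chart `x₃ = w·x₄`: `JDen(w·x₄, x₄) = x₄⁴⁵ · 8(w² − w − 1)¹⁵`.
[cite: FreitasLeHungSiksek2015, §5.3, eqn (js3s5) (arXiv:1310.7088 p. 27)] -/
theorem s3s5JDen_chart (w x₄ : R) :
    s3s5JDen (w * x₄) x₄ = x₄ ^ 45 * (8 * (w ^ 2 - w - 1) ^ 15) := by
  simp only [s3s5JDen]; ring

/-- The printed numerator in the chart `x₃ = w·x₄`, `x₂·w = v·x₄` (i.e. `v = x₂x₃/x₄²`):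
`JNum(x₂, w·x₄, x₄) = x₄⁴⁵ · (R₁(w) + R₂(w)·v)³`.
[cite: FreitasLeHungSiksek2015, §5.3, eqn (js3s5) (arXiv:1310.7088 p. 27)] -/
theorem s3s5JNum_chart (x₂ w v x₄ : R) (hv : x₂ * w = v * x₄) :
    s3s5JNum x₂ (w * x₄) x₄ = x₄ ^ 45 * (s3s5R₁ w 1 + s3s5R₂ w 1 * v) ^ 3 := by
  have h : s3s5R₁ (w * x₄) x₄ + s3s5R₂ (w * x₄) x₄ * x₂ * (w * x₄) =
      x₄ ^ 15 * (s3s5R₁ w 1 + s3s5R₂ w 1 * v) := by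
    rw [s3s5R₁_smul, s3s5R₂_smul]
    linear_combination (x₄ ^ 14 * s3s5R₂ w 1) * hv
  simp only [s3s5JNum]
  rw [h]; ring

/-- The printed polynomials commute with ring homomorphisms. [folklore] -/
theorem map_s3s5R₁ {S : Type*} [CommRing S] (f : R →+* S) (a b : R) :
    f (s3s5R₁ a b) = s3s5R₁ (f a) (f b) := by
  simp only [s3s5R₁, map_add, map_sub, map_mul, map_pow, map_ofNat]

/-- The printed polynomials commute with ring homomorphisms. [folklore] -/
theorem map_s3s5R₂ {S : Type*} [CommRing S] (f : R →+* S) (a b : R) :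
    f (s3s5R₂ a b) = s3s5R₂ (f a) (f b) := by
  simp only [s3s5R₂, map_add, map_sub, map_mul, map_pow, map_ofNat]

end Homogeneity

/-- "(js3s5) involves only `w` and `v`": if `w, v ∈ ℚ⟮r⟯` then the printed `j`-value
`(R₁(w) + R₂(w)v)³ / (8(w² − w − 1)¹⁵)` lies in `ℚ⟮r⟯` (a subfield is closed under field
operations). [cite: FreitasLeHungSiksek2015, §5.3, after eqn (js3s5) (arXiv:1310.7088 p. 27)] -/
theorem s3s5_jValue_mem_adjoin {K : Type} [Field K] [CharZero K] {r w v : K} (hw : w ∈ ℚ⟮r⟯)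
    (hv : v ∈ ℚ⟮r⟯) :
    (s3s5R₁ w 1 + s3s5R₂ w 1 * v) ^ 3 / (8 * (w ^ 2 - w - 1) ^ 15) ∈ ℚ⟮r⟯ := by
  have h1 : (1 : K) ∈ ℚ⟮r⟯ := one_mem _
  have hR₁ : s3s5R₁ w 1 ∈ ℚ⟮r⟯ := by
    have h := map_s3s5R₁ (algebraMap ℚ⟮r⟯ K) ⟨w, hw⟩ 1
    simp only [map_one, IntermediateField.algebraMap_apply] at h
    convert SetLike.coe_mem (s3s5R₁ (⟨w, hw⟩ : ℚ⟮r⟯) 1) using 1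
    exact h.symm
  have hR₂ : s3s5R₂ w 1 ∈ ℚ⟮r⟯ := by
    have h := map_s3s5R₂ (algebraMap ℚ⟮r⟯ K) ⟨w, hw⟩ 1
    simp only [map_one, IntermediateField.algebraMap_apply] at h
    convert SetLike.coe_mem (s3s5R₂ (⟨w, hw⟩ : ℚ⟮r⟯) 1) using 1
    exact h.symm
  exact div_mem (pow_mem (add_mem hR₁ (mul_mem hR₂ hv)) 3)
    (mul_mem (ofNat_mem _ 8) (pow_mem (sub_mem (sub_mem (pow_mem hw 2) hw) h1) 15))

/-! ### §3 `CertS3H8` from the printed fact and the COORDINATE form of the certified datum -/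

/-- The kernel step «`w, v ∈ k` ⇒ `j ∈ k`» on FLS's printed canonical model: if, whenever
`x₄ ≠ 0` and `x₃² − x₃x₄ − x₄² ≠ 0`, the coordinates `w = x₃/x₄` and `v = x₂x₃/x₄²` lie in
`ℚ + ℚ·r` (division-free: `x₃ = (a + b r)·x₄`, `x₂x₃ = (a + b r)·x₄²`), then the printed
`j`-denominator vanishes or `JNum = (a + b r)·JDen` — the shape of `hE9` in `certS3H8_of_facts`.
Proof: `JNum = x₄⁴⁵(R₁(w) + R₂(w)v)³`, `JDen = x₄⁴⁵·8(w² − w − 1)¹⁵ ≠ 0`, and the quotient lies in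
the subfield `ℚ⟮r⟯ = {a + b·r}`. [cite: FreitasLeHungSiksek2015, §5.3, eqn (js3s5) (arXiv:1310.7088 p. 27)] -/
theorem s3s5JDen_eq_zero_or_jNum_eq_of_coords {K : Type} [Field K] [CharZero K] {r : K}
    (hr : r ^ 2 = 5) (x₂ x₃ x₄ : K)
    (hc : x₄ ≠ 0 → x₃ ^ 2 - x₃ * x₄ - x₄ ^ 2 ≠ 0 →
      (∃ a b : ℚ, x₃ = ((a : K) + (b : K) * r) * x₄) ∧
      (∃ a b : ℚ, x₂ * x₃ = ((a : K) + (b : K) * r) * x₄ ^ 2)) :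
    s3s5JDen x₃ x₄ = 0 ∨
      ∃ a b : ℚ, s3s5JNum x₂ x₃ x₄ = ((a : K) + (b : K) * r) * s3s5JDen x₃ x₄ := by
  by_cases hD : s3s5JDen x₃ x₄ = 0
  · exact Or.inl hD
  refine Or.inr ?_
  have hD' : ¬ (x₄ * (x₃ ^ 2 - x₃ * x₄ - x₄ ^ 2) = 0) :=
    fun h => hD ((s3s5JDen_eq_zero_iff x₃ x₄).mpr h)
  have h4 : x₄ ≠ 0 := fun h => hD' (by rw [h, zero_mul])
  have hR3 : x₃ ^ 2 - x₃ * x₄ - x₄ ^ 2 ≠ 0 := fun h => hD' (by rw [h, mul_zero])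
  obtain ⟨⟨a₁, b₁, hw⟩, ⟨a₂, b₂, hv⟩⟩ := hc h4 hR3
  set w : K := (a₁ : K) + (b₁ : K) * r with hw_def
  set v : K := (a₂ : K) + (b₂ : K) * r with hv_def
  have hwm : w ∈ ℚ⟮r⟯ := (mem_adjoin_sqrt_five_iff hr w).mpr ⟨a₁, b₁, rfl⟩
  have hvm : v ∈ ℚ⟮r⟯ := (mem_adjoin_sqrt_five_iff hr v).mpr ⟨a₂, b₂, rfl⟩
  -- `x₂·w = v·x₄`
  have hv' : x₂ * w = v * x₄ := by
    have h : x₂ * w * x₄ = v * x₄ * x₄ := by rw [mul_assoc, ← hw, hv]; ring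
    exact mul_right_cancel₀ h4 h
  -- the printed pieces in the chart
  have hNum : s3s5JNum x₂ x₃ x₄ = x₄ ^ 45 * (s3s5R₁ w 1 + s3s5R₂ w 1 * v) ^ 3 := by
    rw [hw]; exact s3s5JNum_chart x₂ w v x₄ hv'
  have hDen : s3s5JDen x₃ x₄ = x₄ ^ 45 * (8 * (w ^ 2 - w - 1) ^ 15) := by
    rw [hw]; exact s3s5JDen_chart w x₄
  have hden0 : 8 * (w ^ 2 - w - 1) ^ 15 ≠ 0 := by
    have hw2 : w ^ 2 - w - 1 ≠ 0 := by
      intro h0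
      apply hR3
      rw [hw]; linear_combination x₄ ^ 2 * h0
    exact mul_ne_zero (by norm_num) (pow_ne_zero 15 hw2)
  -- the `j`-value lies in `ℚ⟮r⟯`
  obtain ⟨a, b, hab⟩ := (mem_adjoin_sqrt_five_iff hr _).mp (s3s5_jValue_mem_adjoin hwm hvm)
  refine ⟨a, b, ?_⟩
  have hN : (s3s5R₁ w 1 + s3s5R₂ w 1 * v) ^ 3 =
      ((a : K) + (b : K) * r) * (8 * (w ^ 2 - w - 1) ^ 15) := by
    rw [← hab, div_mul_cancel₀ _ hden0]
  rw [hNum, hDen, hN]; ring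

/-- **`CertS3H8` from `FLS2015.s3s5_jRelation_of_isTorsionGaloisRep` (print) and the certified
computation in COORDINATE form.**  `hE9c` «CERT-E9′ (coordinates)»: for `K` totally real quartic
with `r ∈ K`, `r² = 5`, at every point `(x₁ : x₂ : x₃ : x₄)` of FLS's printed canonical model of
`X(s3,s5)` with `x₄ ≠ 0` and `x₃² − x₃x₄ − x₄² ≠ 0` (the affine chart, off the fourteen zeros of the
printed denominator), `w = x₃/x₄ ∈ ℚ + ℚ·r` and `v = x₂x₃/x₄² ∈ ℚ + ℚ·r`, division-free — the
LITERAL output of both lineages (eng-9 E9-COARSE 75c718e0b5108ddd §1–3: «every affine `K`-point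
`(w,u,v)` of (s3s5), `K ⊇ k` totally real quadratic, has `w ∈ k` and `v ∈ k`»; eng-3 E9-RESULT
00025806a59bf964 §3, descent (A)/(B1)/(B2); certnum RELEASES l.131 TORJ2, l.132 TORE, l.133 SQC,
l.134 PT; rank-`0` inputs l.123 LV0 + FLS §5.2 p. 24 PRINTED ranks; Katz; Kani–Rosen — see the
CertS3H8 module docstring), WEAKER than `hE9` of `certS3H8_of_facts` (no `j` in it).  The step
«`w, v ∈ k` ⇒ `j ∈ k`» is `s3s5JDen_eq_zero_or_jNum_eq_of_coords`.  Conclusion = the route child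
`CertS3H8` (stmt-Langlands-23415) BY NAME, via `certS3H8_of_facts`.  CONDITIONAL on the two inputs;
«a certified finite datum is not a modularity statement».
[cite: FreitasLeHungSiksek2015, §2.2 and §5.3 (arXiv:1310.7088 pp. 9, 26–27)] -/
theorem certS3H8_of_facts_coords (hM : FLS2015.s3s5_jRelation_of_isTorsionGaloisRep)
    (hE9c : ∀ (K : Type) [Field K] [NumberField K], NumberField.IsTotallyReal K →
      Module.finrank ℚ K = 4 → ∀ r : K, r ^ 2 = 5 → ∀ x₁ x₂ x₃ x₄ : K,
        s3s5Quadric x₁ x₂ x₃ x₄ = 0 → s3s5Cubic x₁ x₂ x₃ x₄ = 0 →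
          x₄ ≠ 0 → x₃ ^ 2 - x₃ * x₄ - x₄ ^ 2 ≠ 0 →
            (∃ a b : ℚ, x₃ = ((a : K) + (b : K) * r) * x₄) ∧
            (∃ a b : ℚ, x₂ * x₃ = ((a : K) + (b : K) * r) * x₄ ^ 2)) :
    CertS3H8 :=
  certS3H8_of_facts hM fun K _ _ hK hd r hr x₁ x₂ x₃ x₄ _ hQ hC =>
    s3s5JDen_eq_zero_or_jNum_eq_of_coords hr x₂ x₃ x₄ (hE9c K hK hd r hr x₁ x₂ x₃ x₄ hQ hC)

/-! ### §4 Kernel anchors: the two exceptional families of E9′ on the printed affine model -/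

/-- A totally real number field contains no `x` with `x² = −n`, `n ≥ 1` (apply one real
embedding). [folklore] -/
theorem sq_ne_neg_nat_of_isTotallyReal {K : Type} [Field K] [NumberField K]
    (hK : NumberField.IsTotallyReal K) (x : K) (n : ℕ) (hn : 0 < n) : x ^ 2 ≠ -(n : K) := by
  intro hx
  haveI := hK
  obtain ⟨φ⟩ := (inferInstance : Nonempty (K →+* ℂ))
  have hφ : NumberField.ComplexEmbedding.IsReal φ :=
    NumberField.IsTotallyReal.complexEmbedding_isReal φ
  have h := congrArg hφ.embedding hx
  rw [map_pow, map_neg, map_natCast] at h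
  have h0 : (0 : ℝ) ≤ hφ.embedding x ^ 2 := sq_nonneg _
  have h1 : (0 : ℝ) < (n : ℝ) := Nat.cast_pos.mpr hn
  linarith

/-- **E9′ exceptional family 1 (the pair over `k(√−3)`).**  On FLS's printed affine model (s3s5)
`u² = w(w−1)(w²−w+4)`, `v² = w(w³−4w²+12w−12)`: at `w = 1`, `u = 0`, `v² = −3`, the printed
`R₁(1) = R₂(1) = 12`, and the printed `j`-map takes the value `1728`:
`(R₁(1) + R₂(1)v)³ = 1728 · 8(1 − 1 − 1)¹⁵` (`= −13824`).  By `sq_ne_neg_nat_of_isTotallyReal`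
no such point lies over a totally real field. [cite: FreitasLeHungSiksek2015, §5.3, (s3s5) and (js3s5) (arXiv:1310.7088 pp. 26–27)] -/
theorem s3s5_exceptional_w_one {K : Type*} [Field K] (u v : K)
    (hu : u ^ 2 = 1 * (1 - 1) * (1 ^ 2 - 1 + 4)) (hv : v ^ 2 = 1 * (1 ^ 3 - 4 * 1 ^ 2 + 12 * 1 - 12)) :
    u = 0 ∧ v ^ 2 = -3 ∧ s3s5R₁ (1 : K) 1 = 12 ∧ s3s5R₂ (1 : K) 1 = 12 ∧
      (s3s5R₁ (1 : K) 1 + s3s5R₂ 1 1 * v) ^ 3 = 1728 * (8 * ((1 : K) ^ 2 - 1 - 1) ^ 15) := by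
  have hR₁ : s3s5R₁ (1 : K) 1 = 12 := by norm_num [s3s5R₁]
  have hR₂ : s3s5R₂ (1 : K) 1 = 12 := by norm_num [s3s5R₂]
  have hv' : v ^ 2 = -3 := by rw [hv]; ring
  refine ⟨pow_eq_zero_iff (two_ne_zero) |>.mp (by rw [hu]; ring), hv', hR₁, hR₂, ?_⟩
  rw [hR₁, hR₂]
  linear_combination (1728 * (v + 3)) * hv'

/-- **E9′ exceptional family 2 (the points over `k(√−15)`).**  On FLS's printed affine model (s3s5):
if `w² − w + 4 = 0` (so `(2w − 1)² = −15`) then `u = 0`, `v² = 5(w − 4)` (`= 5·((1 ± √−15)/2)²`,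
so `v ∈ ℚ(√5, √−15)`), the printed `R₁(w) = 37500`, `R₂(w) = −1875w − 13125`, `w² − w − 1 = −5`,
and the printed `j`-map takes the value `1728`: `(R₁(w) + R₂(w)v)³ = 1728 · 8(w² − w − 1)¹⁵`
(explicit cofactors).  By `sq_ne_neg_nat_of_isTotallyReal` (`(2w−1)² = −15`) no such point lies
over a totally real field. [cite: FreitasLeHungSiksek2015, §5.3, (s3s5) and (js3s5) (arXiv:1310.7088 pp. 26–27)] -/
theorem s3s5_exceptional_w_sq {K : Type*} [Field K] (w u v : K) (hw : w ^ 2 - w + 4 = 0)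
    (hu : u ^ 2 = w * (w - 1) * (w ^ 2 - w + 4)) (hv : v ^ 2 = w * (w ^ 3 - 4 * w ^ 2 + 12 * w - 12)) :
    (2 * w - 1) ^ 2 = -15 ∧ u = 0 ∧ v ^ 2 = 5 * (w - 4) ∧ s3s5R₁ w 1 = 37500 ∧
      s3s5R₂ w 1 = -1875 * w - 13125 ∧ w ^ 2 - w - 1 = -5 ∧
      (s3s5R₁ w 1 + s3s5R₂ w 1 * v) ^ 3 = 1728 * (8 * (w ^ 2 - w - 1) ^ 15) := by
  have hv' : v ^ 2 = 5 * (w - 4) := by linear_combination hv + (w ^ 2 - 3 * w + 5) * hw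
  have hR₁ : s3s5R₁ w 1 = 37500 := by
    simp only [s3s5R₁]
    linear_combination (-9408 - 1347 * w - 2856 * w ^ 2 + 10474 * w ^ 3 - 10690 * w ^ 4
      + 6477 * w ^ 5 - 2472 * w ^ 6 + 379 * w ^ 7 + 114 * w ^ 8 - 20 * w ^ 9 - 47 * w ^ 10
      + 32 * w ^ 11 - 9 * w ^ 12 + w ^ 13) * hw
  have hR₂ : s3s5R₂ w 1 = -1875 * w - 13125 := by
    simp only [s3s5R₂]
    linear_combination (3360 + 630 * w + 1242 * w ^ 2 - 2651 * w ^ 3 + 1448 * w ^ 4 - 269 * w ^ 5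
      + 22 * w ^ 6 - 44 * w ^ 7 + 7 * w ^ 8 + 14 * w ^ 9 - 7 * w ^ 10 + w ^ 11) * hw
  have hR₃ : w ^ 2 - w - 1 = -5 := by linear_combination hw
  refine ⟨by linear_combination 4 * hw, pow_eq_zero_iff (two_ne_zero) |>.mp ?_, hv', hR₁, hR₂, hR₃, ?_⟩
  · rw [hu]; linear_combination (w * (w - 1)) * hw
  rw [hR₁, hR₂, hR₃]
  linear_combination (395507812500 * w ^ 2 + 5537109375000 * w + 19379882812500
      - 6591796875 * w ^ 3 * v - 138427734375 * w ^ 2 * v - 968994140625 * w * v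
      - 2260986328125 * v) * hv' +
    (1977539062500 * w + 21752929687500 - 32958984375 * w ^ 2 * v - 593261718750 * w * v
      - 2537841796875 * v) * hw

end Summit.Langlands.Langlands.Theorems.SqrtFiveQuarticCovers

end
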